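import Literature.Analysis.PDE.ConservationLawWeakStrong

/-!
# Structural lemmas of Dafermos' relative-entropy argument (Thm 5.2.1), proved

Three ingredients of the printed proof of the weak–strong stability theorem (Dafermos 2000,
Theorem 5.2.1, pp. 126–128 of the held scan [Dafermos2000]) in the vocabulary of
`ConservationLawWeakStrong.lean` (`IsConvexEntropySystem`), all PROVED:

* `IsConvexEntropySystem.hessian_flux_symm` — (4.3.2) from (4.3.1): differentiating the
  compatibility `Dq_α = Dη DG_α` on the open state domain gives the symmetry
  `D²η(V)[ξ, DG_α(V)ζ] = D²η(V)[ζ, DG_α(V)ξ]`;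
* `IsConvexEntropySystem.relEntropy_lower_bound` — (5.2.2) is positive definite on a convex
  compact `𝒟`: `η(U) - η(Ū) - Dη(Ū)[U-Ū] ≥ (λ/2)|U-Ū|²`;
* `exists_taylor_two_bound_of_convex_compact` — "all of quadratic order in `U - Ū`" (p. 126):
  `‖F(U) - F(Ū) - DF(Ū)[U-Ū]‖ ≤ C|U-Ū|²` on `𝒟 × 𝒟` for `F` smooth on the open `𝒪 ⊇ 𝒟`.

They serve the corrected transcription of Thm 5.2.1 (with the Lipschitz constant of `Ū`
explicit); the uncorrected `dafermos_weak_strong_stability` is refuted in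
`ConservationLawWeakStrongCounterexample.lean`.

## References
* [Dafermos2000] C. M. Dafermos, *Hyperbolic Conservation Laws in Continuum Physics*, Springer
  2000, §4.3 (4.3.1)–(4.3.2) p. 113, §5.2 Thm 5.2.1 (5.2.2)–(5.2.5) pp. 126–128 of the held scan.
-/

noncomputable section

open Set Filter
open scoped Topology

namespace Literature.Analysis.PDE

namespace ConservationLaw

variable {m n : ℕ}

/-- **Compatibility of entropy and flux differentiates to the symmetry `D²η DG_α = DG_αᵀ D²η`**
(Dafermos 2000 (4.3.2), PDF p. 113 of the held scan; derived in §3.2): for a system endowed with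
an entropy–entropy-flux pair in the sense of `IsConvexEntropySystem`, at every state `V ∈ 𝒪`,
`D²η(V)[ξ, DG_α(V)ζ] = D²η(V)[ζ, DG_α(V)ξ]` for all `ξ, ζ`. Proof as printed: differentiate
`Dq_α = Dη DG_α` (4.3.1) once on the open set `𝒪` and use the symmetry of `D²q_α` and `D²G_α`.
[cite: Dafermos2000, §4.3 (4.3.2)] -/
theorem IsConvexEntropySystem.hessian_flux_symm {O : Set (EuclideanSpace ℝ (Fin n))}
    {G : Fin m → EuclideanSpace ℝ (Fin n) → EuclideanSpace ℝ (Fin n)}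
    {η : EuclideanSpace ℝ (Fin n) → ℝ} {q : Fin m → EuclideanSpace ℝ (Fin n) → ℝ}
    (h : IsConvexEntropySystem O G η q) {V : EuclideanSpace ℝ (Fin n)} (hV : V ∈ O) (α : Fin m)
    (ξ ζ : EuclideanSpace ℝ (Fin n)) :
    iteratedFDeriv ℝ 2 η V ![ξ, fderiv ℝ (G α) V ζ]
      = iteratedFDeriv ℝ 2 η V ![ζ, fderiv ℝ (G α) V ξ] := by
  obtain ⟨hO, hG, hη, hq, hcompat, -⟩ := h
  have hOV : O ∈ 𝓝 V := hO.mem_nhds hV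
  -- smoothness at `V`
  have hηV : ContDiffAt ℝ (⊤ : ℕ∞) η V := (hη.contDiffAt hOV)
  have hGV : ContDiffAt ℝ (⊤ : ℕ∞) (G α) V := ((hG α).contDiffAt hOV)
  have hqV : ContDiffAt ℝ (⊤ : ℕ∞) (q α) V := ((hq α).contDiffAt hOV)
  -- derivatives of the first derivatives
  have hη1 : HasFDerivAt (fderiv ℝ η) (fderiv ℝ (fderiv ℝ η) V) V :=
    ((hηV.fderiv_right (m := 1) (WithTop.coe_le_coe.2 le_top)).differentiableAt
      one_ne_zero).hasFDerivAt
  have hG1 : HasFDerivAt (fderiv ℝ (G α)) (fderiv ℝ (fderiv ℝ (G α)) V) V :=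
    ((hGV.fderiv_right (m := 1) (WithTop.coe_le_coe.2 le_top)).differentiableAt
      one_ne_zero).hasFDerivAt
  have hq1 : HasFDerivAt (fderiv ℝ (q α)) (fderiv ℝ (fderiv ℝ (q α)) V) V :=
    ((hqV.fderiv_right (m := 1) (WithTop.coe_le_coe.2 le_top)).differentiableAt
      one_ne_zero).hasFDerivAt
  -- the compatibility relation holds on a neighbourhood, hence differentiates
  have hEq : (fun W => fderiv ℝ (q α) W) =ᶠ[𝓝 V]
      fun W => (fderiv ℝ η W).comp (fderiv ℝ (G α) W) := by
    filter_upwards [hOV] with W hW using hcompat W hW α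
  have hprod := hη1.clm_comp hG1
  have hD : fderiv ℝ (fderiv ℝ (q α)) V
      = (ContinuousLinearMap.compL ℝ (EuclideanSpace ℝ (Fin n)) (EuclideanSpace ℝ (Fin n)) ℝ
          (fderiv ℝ η V)).comp (fderiv ℝ (fderiv ℝ (G α)) V)
        + ((ContinuousLinearMap.compL ℝ (EuclideanSpace ℝ (Fin n)) (EuclideanSpace ℝ (Fin n))
            ℝ).flip
            (fderiv ℝ (G α) V)).comp
            (fderiv ℝ (fderiv ℝ η) V) := by
    rw [hEq.fderiv_eq]
    exact hprod.fderiv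
  -- evaluate at `(ξ, ζ)` and at `(ζ, ξ)`
  have hDapp : ∀ v w : EuclideanSpace ℝ (Fin n), fderiv ℝ (fderiv ℝ (q α)) V v w
      = fderiv ℝ η V (fderiv ℝ (fderiv ℝ (G α)) V v w)
        + fderiv ℝ (fderiv ℝ η) V v (fderiv ℝ (G α) V w) := by
    intro v w
    rw [hD]
    simp [ContinuousLinearMap.comp_apply, ContinuousLinearMap.compL_apply,
      ContinuousLinearMap.flip_apply]
  -- symmetry of the second derivatives of `q α` and `G α`
  have hsq : IsSymmSndFDerivAt ℝ (q α) V := hqV.isSymmSndFDerivAt (by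
    rw [minSmoothness_of_isRCLikeNormedField]; decide)
  have hsG : IsSymmSndFDerivAt ℝ (G α) V := hGV.isSymmSndFDerivAt (by
    rw [minSmoothness_of_isRCLikeNormedField]; decide)
  have key := hDapp ξ ζ
  rw [hsq ξ ζ, hDapp ζ ξ, hsG ζ ξ, add_right_inj] at key
  rw [iteratedFDeriv_two_apply, iteratedFDeriv_two_apply]
  simpa using key.symm

/-- **The relative entropy is positive definite on a convex compact set of states** (Dafermos
2000, proof of Thm 5.2.1, (5.2.2) and p. 128: "`h(U, Ū)` is positive definite, due to the
convexity of `η`"): if `D²η ≥ λ` on the convex compact `𝒟 ⊆ 𝒪` (the uniform convexity clause of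
`IsConvexEntropySystem`), then
`h(U, Ū) := η(U) - η(Ū) - Dη(Ū)[U - Ū] ≥ (λ/2) |U - Ū|²` for all `U, Ū ∈ 𝒟`.
Proof: along the segment `θ ↦ Ū + θ(U - Ū) ⊆ 𝒟`, the function
`θ ↦ η - η(Ū) - θ Dη(Ū)[ξ] - (λ/2)θ²|ξ|²` has vanishing value and derivative at `0` and a
nonnegative second derivative, hence is nonnegative at `θ = 1` (two monotonicity steps).
[cite: Dafermos2000, Thm 5.2.1 (5.2.2)] -/
theorem IsConvexEntropySystem.relEntropy_lower_bound {O : Set (EuclideanSpace ℝ (Fin n))}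
    {G : Fin m → EuclideanSpace ℝ (Fin n) → EuclideanSpace ℝ (Fin n)}
    {η : EuclideanSpace ℝ (Fin n) → ℝ} {q : Fin m → EuclideanSpace ℝ (Fin n) → ℝ}
    (h : IsConvexEntropySystem O G η q) {D : Set (EuclideanSpace ℝ (Fin n))} (hDO : D ⊆ O)
    (hDc : IsCompact D) (hDconv : Convex ℝ D) :
    ∃ c > (0 : ℝ), ∀ U ∈ D, ∀ Ubar ∈ D,
      c * ‖U - Ubar‖ ^ 2 ≤ η U - η Ubar - fderiv ℝ η Ubar (U - Ubar) := by
  obtain ⟨hO, -, hη, -, -, hconv⟩ := h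
  obtain ⟨lam, hlam, hlow⟩ := hconv D hDO hDc
  refine ⟨lam / 2, by positivity, fun U hU Ubar hUbar => ?_⟩
  set ξ : EuclideanSpace ℝ (Fin n) := U - Ubar with hξ
  -- the segment and the restriction of `η` to it
  set γ : ℝ → EuclideanSpace ℝ (Fin n) := fun θ => Ubar + θ • ξ with hγ
  have hγD : ∀ θ ∈ Icc (0 : ℝ) 1, γ θ ∈ D := by
    intro θ hθ
    have := hDconv hUbar hU (sub_nonneg.2 hθ.2) hθ.1 (by ring)
    convert this using 1
    rw [show γ θ = Ubar + θ • (U - Ubar) from rfl, smul_sub, sub_smul, one_smul]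
    abel
  have hγd : ∀ θ, HasDerivAt γ ξ θ := fun θ => by
    simpa [hγ] using ((hasDerivAt_id θ).smul_const ξ).const_add Ubar
  -- first and second derivatives along the segment, at points mapped into `O`
  set g : ℝ → ℝ := fun θ => η (γ θ) with hg
  set g' : ℝ → ℝ := fun θ => fderiv ℝ η (γ θ) ξ with hg'
  set g'' : ℝ → ℝ := fun θ => fderiv ℝ (fderiv ℝ η) (γ θ) ξ ξ with hg''
  have hηat : ∀ θ, γ θ ∈ O → ContDiffAt ℝ (⊤ : ℕ∞) η (γ θ) := fun θ hθ =>
    hη.contDiffAt (hO.mem_nhds hθ)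
  have hg1 : ∀ θ, γ θ ∈ O → HasDerivAt g (g' θ) θ := by
    intro θ hθ
    have hd : HasFDerivAt η (fderiv ℝ η (γ θ)) (γ θ) :=
      ((hηat θ hθ).differentiableAt (by simp)).hasFDerivAt
    exact hd.comp_hasDerivAt θ (hγd θ)
  have hg2 : ∀ θ, γ θ ∈ O → HasDerivAt g' (g'' θ) θ := by
    intro θ hθ
    have hd : HasFDerivAt (fderiv ℝ η) (fderiv ℝ (fderiv ℝ η) (γ θ)) (γ θ) :=
      (((hηat θ hθ).fderiv_right (m := 1) (WithTop.coe_le_coe.2 le_top)).differentiableAt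
        one_ne_zero).hasFDerivAt
    have h1 : HasDerivAt (fun θ' => fderiv ℝ η (γ θ')) (fderiv ℝ (fderiv ℝ η) (γ θ) ξ) θ :=
      hd.comp_hasDerivAt θ (hγd θ)
    exact h1.clm_apply (hasDerivAt_const θ ξ) |>.congr_deriv (by simp [hg''])
  have hg2low : ∀ θ ∈ Icc (0 : ℝ) 1, lam * ‖ξ‖ ^ 2 ≤ g'' θ := by
    intro θ hθ
    have := hlow (γ θ) (hγD θ hθ) ξ
    rwa [iteratedFDeriv_two_apply] at this
  -- the open set of parameters mapped into `O` contains `[0, 1]`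
  have hIO : ∀ θ ∈ Icc (0 : ℝ) 1, γ θ ∈ O := fun θ hθ => hDO (hγD θ hθ)
  -- the auxiliary function and its derivative
  set φ : ℝ → ℝ := fun θ => g θ - g 0 - θ * g' 0 - lam / 2 * θ ^ 2 * ‖ξ‖ ^ 2 with hφ
  set φ' : ℝ → ℝ := fun θ => g' θ - g' 0 - lam * θ * ‖ξ‖ ^ 2 with hφ'
  have hφd : ∀ θ ∈ Icc (0 : ℝ) 1, HasDerivAt φ (φ' θ) θ := by
    intro θ hθ
    have h1 := hg1 θ (hIO θ hθ)
    have h2 : HasDerivAt (fun θ' : ℝ => θ' * g' 0) (g' 0) θ := by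
      simpa using (hasDerivAt_id θ).mul_const (g' 0)
    have h3 : HasDerivAt (fun θ' : ℝ => lam / 2 * θ' ^ 2 * ‖ξ‖ ^ 2) (lam * θ * ‖ξ‖ ^ 2) θ := by
      have := ((hasDerivAt_pow 2 θ).const_mul (lam / 2)).mul_const (‖ξ‖ ^ 2)
      refine this.congr_deriv ?_
      simp only [Nat.cast_ofNat, Nat.add_one_sub_one, pow_one]
      ring
    have := ((h1.sub_const (g 0)).sub h2).sub h3
    exact this.congr_deriv (by simp [hφ'])
  have hφ'd : ∀ θ ∈ Icc (0 : ℝ) 1, HasDerivAt φ' (g'' θ - lam * ‖ξ‖ ^ 2) θ := by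
    intro θ hθ
    have h1 := hg2 θ (hIO θ hθ)
    have h3 : HasDerivAt (fun θ' : ℝ => lam * θ' * ‖ξ‖ ^ 2) (lam * ‖ξ‖ ^ 2) θ := by
      simpa using ((hasDerivAt_id θ).const_mul lam).mul_const (‖ξ‖ ^ 2)
    exact ((h1.sub_const (g' 0)).sub h3)
  -- `φ'` is monotone on `[0,1]`, hence nonnegative; then `φ` is monotone, hence `φ 1 ≥ φ 0 = 0`
  have hφ'mono : MonotoneOn φ' (Icc 0 1) := by
    refine monotoneOn_of_deriv_nonneg (convex_Icc 0 1) ?_ ?_ ?_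
    · exact fun θ hθ => (hφ'd θ hθ).continuousAt.continuousWithinAt
    · rw [interior_Icc]
      exact fun θ hθ => (hφ'd θ (Ioo_subset_Icc_self hθ)).differentiableAt.differentiableWithinAt
    · rw [interior_Icc]
      intro θ hθ
      rw [(hφ'd θ (Ioo_subset_Icc_self hθ)).deriv]
      linarith [hg2low θ (Ioo_subset_Icc_self hθ)]
  have hφ'nonneg : ∀ θ ∈ Icc (0 : ℝ) 1, 0 ≤ φ' θ := by
    intro θ hθ
    have h0 : φ' 0 = 0 := by simp [hφ']
    rw [← h0]
    exact hφ'mono ⟨le_rfl, zero_le_one⟩ hθ hθ.1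
  have hφmono : MonotoneOn φ (Icc 0 1) := by
    refine monotoneOn_of_deriv_nonneg (convex_Icc 0 1) ?_ ?_ ?_
    · exact fun θ hθ => (hφd θ hθ).continuousAt.continuousWithinAt
    · rw [interior_Icc]
      exact fun θ hθ => (hφd θ (Ioo_subset_Icc_self hθ)).differentiableAt.differentiableWithinAt
    · rw [interior_Icc]
      intro θ hθ
      rw [(hφd θ (Ioo_subset_Icc_self hθ)).deriv]
      exact hφ'nonneg θ (Ioo_subset_Icc_self hθ)
  have hφ1 : 0 ≤ φ 1 := by
    have h0 : φ 0 = 0 := by simp [hφ]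
    rw [← h0]
    exact hφmono ⟨le_rfl, zero_le_one⟩ ⟨zero_le_one, le_rfl⟩ zero_le_one
  -- unfold at `θ = 1`
  have hγ1 : γ 1 = U := by simp [hγ, hξ]
  have hγ0 : γ 0 = Ubar := by simp [hγ]
  simp only [hφ, hg, hg', hγ1, hγ0, one_mul, one_pow, mul_one] at hφ1
  rw [hξ] at hφ1 ⊢
  linarith

/-- **Second-order Taylor bound on a convex compact set of states** ("all of quadratic order in
`U - Ū`", Dafermos 2000 p. 126, for `h`, `f_α`, `Z_α` of (5.2.2)–(5.2.4)): if `F` is smooth on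
the open `𝒪 ⊇ 𝒟`, `𝒟` convex compact, then
`‖F(U) - F(Ū) - DF(Ū)[U - Ū]‖ ≤ C |U - Ū|²` on `𝒟 × 𝒟`, with `C = sup_𝒟 ‖D²F‖`.
Proof: mean value inequality for `DF` on `𝒟`, then for `θ ↦ F(Ū + θξ) - θ DF(Ū)ξ` on `[0,1]`.
[folklore] -/
theorem exists_taylor_two_bound_of_convex_compact {F' : Type*} [NormedAddCommGroup F']
    [NormedSpace ℝ F'] {O D : Set (EuclideanSpace ℝ (Fin n))} {F : EuclideanSpace ℝ (Fin n) → F'}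
    (hO : IsOpen O) (hF : ContDiffOn ℝ (⊤ : ℕ∞) F O) (hDO : D ⊆ O) (hDc : IsCompact D)
    (hDconv : Convex ℝ D) :
    ∃ C : ℝ, 0 ≤ C ∧ ∀ U ∈ D, ∀ Ubar ∈ D,
      ‖F U - F Ubar - fderiv ℝ F Ubar (U - Ubar)‖ ≤ C * ‖U - Ubar‖ ^ 2 := by
  -- `D²F` is bounded on `D`
  have hF1 : ContDiffOn ℝ (⊤ : ℕ∞) (fderiv ℝ F) O := hF.fderiv_of_isOpen hO (by simp)
  have hF2 : ContDiffOn ℝ (⊤ : ℕ∞) (fderiv ℝ (fderiv ℝ F)) O := hF1.fderiv_of_isOpen hO (by simp)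
  have hc2 : ContinuousOn (fderiv ℝ (fderiv ℝ F)) D := hF2.continuousOn.mono hDO
  have hcont := fun x (hx : x ∈ D) =>
    ContinuousWithinAt.norm (E := EuclideanSpace ℝ (Fin n) →L[ℝ] EuclideanSpace ℝ (Fin n) →L[ℝ] F')
      (hc2 x hx)
  obtain ⟨M, hM'⟩ := hDc.exists_bound_of_continuousOn hcont
  have hM : ∀ x ∈ D, ‖fderiv ℝ (fderiv ℝ F) x‖ ≤ M := fun x hx => by
    have h := hM' x hx
    rw [Real.norm_eq_abs, abs_of_nonneg (norm_nonneg _)] at h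
    exact h
  refine ⟨|M|, abs_nonneg M, fun U hU Ubar hUbar => ?_⟩
  set ξ : EuclideanSpace ℝ (Fin n) := U - Ubar with hξ
  set γ : ℝ → EuclideanSpace ℝ (Fin n) := fun θ => Ubar + θ • ξ with hγ
  have hγD : ∀ θ ∈ Icc (0 : ℝ) 1, γ θ ∈ D := by
    intro θ hθ
    have := hDconv hUbar hU (sub_nonneg.2 hθ.2) hθ.1 (by ring)
    convert this using 1
    rw [show γ θ = Ubar + θ • (U - Ubar) from rfl, smul_sub, sub_smul, one_smul]
    abel
  have hγd : ∀ θ, HasDerivAt γ ξ θ := fun θ => by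
    simpa [hγ] using ((hasDerivAt_id θ).smul_const ξ).const_add Ubar
  -- mean value inequality for `DF` on `D`
  have hDF : ∀ x ∈ D, DifferentiableAt ℝ (fderiv ℝ F) x := fun x hx =>
    (hF1.contDiffAt (hO.mem_nhds (hDO hx))).differentiableAt (by simp)
  have hDFlip : ∀ θ ∈ Icc (0 : ℝ) 1, ‖fderiv ℝ F (γ θ) - fderiv ℝ F Ubar‖ ≤ |M| * ‖γ θ - Ubar‖ :=
    fun θ hθ => hDconv.norm_image_sub_le_of_norm_fderiv_le hDF
      (fun x hx => (hM x hx).trans (le_abs_self M)) hUbar (hγD θ hθ)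
  -- the function `k θ = F(γ θ) - θ • DF(Ū) ξ` on `[0, 1]`
  set k : ℝ → F' := fun θ => F (γ θ) - θ • fderiv ℝ F Ubar ξ with hk
  have hkd : ∀ θ ∈ Icc (0 : ℝ) 1,
      HasDerivAt k ((fderiv ℝ F (γ θ) - fderiv ℝ F Ubar) ξ) θ := by
    intro θ hθ
    have hFd : HasFDerivAt F (fderiv ℝ F (γ θ)) (γ θ) :=
      ((hF.contDiffAt (hO.mem_nhds (hDO (hγD θ hθ)))).differentiableAt (by simp)).hasFDerivAt
    have h1 : HasDerivAt (fun θ' => F (γ θ')) (fderiv ℝ F (γ θ) ξ) θ :=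
      hFd.comp_hasDerivAt θ (hγd θ)
    have h2 : HasDerivAt (fun θ' : ℝ => θ' • fderiv ℝ F Ubar ξ) (fderiv ℝ F Ubar ξ) θ := by
      simpa using (hasDerivAt_id θ).smul_const (fderiv ℝ F Ubar ξ)
    exact (h1.sub h2).congr_deriv (by simp)
  have hbound : ∀ θ ∈ Ico (0 : ℝ) 1, ‖(fderiv ℝ F (γ θ) - fderiv ℝ F Ubar) ξ‖ ≤ |M| * ‖ξ‖ ^ 2 := by
    intro θ hθ
    have hθ' : θ ∈ Icc (0 : ℝ) 1 := Ico_subset_Icc_self hθ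
    refine (ContinuousLinearMap.le_opNorm _ _).trans ?_
    have hγθ : ‖γ θ - Ubar‖ = θ * ‖ξ‖ := by
      simp only [hγ, add_sub_cancel_left, norm_smul, Real.norm_eq_abs, abs_of_nonneg hθ.1]
    calc ‖fderiv ℝ F (γ θ) - fderiv ℝ F Ubar‖ * ‖ξ‖ ≤ |M| * ‖γ θ - Ubar‖ * ‖ξ‖ := by
          gcongr; exact hDFlip θ hθ'
      _ = |M| * ‖ξ‖ ^ 2 * θ := by rw [hγθ]; ring
      _ ≤ |M| * ‖ξ‖ ^ 2 * 1 := by gcongr; exact hθ.2.le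
      _ = |M| * ‖ξ‖ ^ 2 := mul_one _
  have hmv := norm_image_sub_le_of_norm_deriv_le_segment' (f := k)
    (fun θ hθ => (hkd θ hθ).hasDerivWithinAt) hbound 1 ⟨zero_le_one, le_rfl⟩
  have hk1 : k 1 - k 0 = F U - F Ubar - fderiv ℝ F Ubar (U - Ubar) := by
    simp only [hk, hγ, one_smul, zero_smul, add_zero, sub_zero, hξ, add_sub_cancel]
    abel
  rw [hk1, sub_zero, mul_one] at hmv
  rwa [hξ] at hmv ⊢

end ConservationLaw

end Literature.Analysis.PDE
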